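import Mathlib
import HarnessLib
import Summits.HubbardSuperconductivity.HubbardSuperconductivity.Theorems.KLProgrammeKLRegimeEngineTowerRemeasureLev
import Summits.HubbardSuperconductivity.HubbardSuperconductivity.Theorems.KLProgrammeKLRegimeEngineTowerModelDefsRate
import Summits.HubbardSuperconductivity.HubbardSuperconductivity.Theorems.KLProgrammeKLRegimeEngineNormsJumpResectorisationPrescribedWt
import Summits.HubbardSuperconductivity.HubbardSuperconductivity.Theorems.KLProgrammeKLRegimeSectorMultiplierOverlapWtFlowDeep

/-!
# Route `KLProgramme` — crux K3 ENGINE (stmt-HubbardSuperconductivity-20437 `KLRegimeEngineV17F2`), stub (b) v2, THE LEVELS PACKAGE (ℓ):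
# instantiation (I2), THE JUMP HALF (weighted track) — a weighted pinned sum RE-MEASURED at a finer thin family is at most the BORN weighted size at the
# coarse family times the relative count with one determined leg (E1-LEVELS-BLUEPRINT-g8 §3 (I2); cell gate-hubbard-kl, seat hubbard-kl-k3c2-p3 g10)

Weighted twin of `…EngineTowerRemeasureLev`, in E1's rate-decoupled carrier `klWtPinnedSumAt L M β μ K J j m T q w` (`…EngineTowerModelDefsRate`: family `F_J`,
tree weight `klScaleWt L M β j` of rate `j`, leg `q` pinned at `w`, the other legs summed over positions AND labels).  For a momentum-conserving `T` and thin
families `F_k`, `F_{J′}` with `k + 1 ≤ J′`: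
`klWtPinnedSumAt … J′ j (m+1) T q w ≤ C · (2^{J′−k})^{m−1} · sup_{w′} klWtPinnedSumAt … k j (m+1) T q w′` (same pinned leg, same rate), where `C` is
`c₁^m·c₁r·ε^{m+1}·D·27^{m+1}` from the PAIR-WEIGHTED per-pair column / row sums `c₁`, `c₁r` of `‖E(klAnisoFamily J′)·S(F̃_k)‖` with the weight
`klScaleWt L M β j {·,·}` on the two legs' lattice positions (p3's literal shape, conjuncts 2–3 of `TorusFourierL2.overlapWt_jump_sums_klEng_flow_deep`) and the
relative count with one determined leg (p4 g11's `card_relCount_prescribed_lastLeg_klAniso_le_window`, constant `D`).  The re-sectorisation is k3c2-p3 g6's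
tree-weighted `hubbardSectorPrescribedSumWt_klAniso_jump_le_split` (class `B = ∅`, tree weight `klScaleWt … j`, `isTreeWeight_klScaleWt`).

* §1 `sum_pinned_prod_eq` (a pinned sum over product-valued leg tuples is the label-then-position double sum) and **`klWtPinnedSumAt_succ_eq_sum_sector`** —
  the carrier as `ε^m Σ_{σ : σ q = ℓ} Σ_{x : x q = y} klScaleWt_j(pos x)·‖W^{F_J}_σ(T)(x)‖` (`kernel_map_sectorAnalysis`);
* §2 **`klWtPinnedSumAt_jump_le_of_consts`** — the jump at abstract `c₁`, `c₁r`, `D` (any rate `j`);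
* §3 **`klWtPinnedSumAt_jump_le_klEng_flow_deep`** — constants discharged at the FLOW FRAME `K_n` on p3's deep window `4ⁿ·U ≤ 4^{2(k+1)+d}` (p3's binder list
  verbatim + the count's thresholds `c ≤ c₃′(R)`, `U ≤ U₀′(R)`), every rate `j ≥ J′` (`klScaleWt_le_of_le`); below the window the (F1) supplier of the weighted
  overlap constants plugs into §2 instead.
* §4 (appended) **`klWtPinnedSumAt_klTowerIncr_remeasure_le_klEng_flow_deep`** — the tower row: `Δ_{k′}` (born at `F_{dk′}`) re-measured at `F_{dk−1}` against
  `klTowerBornWtAt … d k′ j (m+1)`, flow frame, deep window at the coarse family, every rate `j ≥ dk − 1`.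
With E1's `klTowerMeasWt_le_remeasured_sum` (linearity) this is the kit's weighted `hμ` row in absolute units; the dimensionless dictionary is E1's (I6)/(I7).
Everything is proved; no definitions; nothing about the model is asserted; nothing asserts superconductivity.
References: BGM 2006 §2.8 (2.76), (2.82)–(2.84), (2.88)–(2.90), App. A3 Lemma A3.1 [cite: BenfattoGiulianiMastropietro2006].
-/

noncomputable section

namespace Summit.HubbardSuperconductivity.HubbardSuperconductivity.Theorems.EngineV8

set_option linter.dupNamespace false -- summit = problem name (single-conjunct summit), D-0017

open Classical
open Real Finset Literature.MathematicalPhysics.QuantumLattice Literature.Probability.LatticeModels GrassmannAlgebra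
open Literature.Probability.LatticeModels.BattleFederbush
open Literature.MathematicalPhysics.QuantumLattice.FermiRG
open Summit.HubbardSuperconductivity.HubbardSuperconductivity.Theorems.KLRegimeSplit
open Summit.HubbardSuperconductivity.HubbardSuperconductivity.Theorems.KLProgrammeLegKernels
open Summit.HubbardSuperconductivity.HubbardSuperconductivity.Theorems.DispersionFlow
open Summit.HubbardSuperconductivity.HubbardSuperconductivity.Theorems.KLRegimeWick
open Summit.HubbardSuperconductivity.HubbardSuperconductivity.Theorems.TorusFourierL2

/-! ## §1 The carrier as a label-then-position double sum -/

section Reindex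

variable {P S : Type*} [Fintype P] [DecidableEq P] [Fintype S] [DecidableEq S] {m : ℕ}

/-- **A pinned sum over product-valued leg tuples is the label-then-position double sum**:
`Σ_{Y : Y p = (x, s)} g (pos Y) (lab Y) = Σ_{Ω : Ω p = s} Σ_{X : X p = x} g X Ω`. [folklore] -/
theorem sum_pinned_prod_eq (g : (Fin (m + 1) → P) → (Fin (m + 1) → S) → ℝ) (p : Fin (m + 1)) (x : P) (s : S) :
    ∑ Y ∈ univ.filter (fun Y : Fin (m + 1) → P × S => Y p = (x, s)), g (fun i => (Y i).1) (fun i => (Y i).2) =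
      ∑ Ω ∈ univ.filter (fun Ω : Fin (m + 1) → S => Ω p = s), ∑ X ∈ univ.filter (fun X : Fin (m + 1) → P => X p = x), g X Ω := by
  rw [sum_filter, ← (Equiv.arrowProdEquivProdArrow (Fin (m + 1)) (fun _ => P) (fun _ => S)).symm.sum_comp, Fintype.sum_prod_type,
    sum_comm, sum_filter]
  refine sum_congr rfl fun Ω _ => ?_
  split_ifs with hΩ
  · rw [sum_filter]
    refine sum_congr rfl fun X _ => ?_
    by_cases hX : X p = x
    · rw [if_pos, if_pos hX]
      · rfl
      · exact Prod.ext hX hΩ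
    · rw [if_neg, if_neg hX]
      exact fun h => hX (congrArg Prod.fst h)
  · refine sum_eq_zero fun X _ => ?_
    rw [if_neg]
    exact fun h => hΩ (congrArg Prod.snd h)

end Reindex

variable {L M : ℕ} [NeZero L] [NeZero M]

omit [NeZero L] [NeZero M] in
/-- The lattice position of a leg forgets the label: `latticeLegPos Ng (x, ℓ) = (2·x.1 mod Ng, x.2)`. -/
theorem image_latticeLegPos_eq_image_pos {m Ns : ℕ} (Y : Fin m → SpaceTimeIdx L M × SectorLeg Ns) :
    (univ.image Y).image (latticeLegPos (2 * (2 * M))) =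
      (univ.image fun i => (Y i).1).image (fun x : SpaceTimeIdx L M => (((((2 * (x.1 : ℕ) : ℕ)) : ZMod (2 * (2 * M)))), x.2)) := by
  rw [Finset.image_image, Finset.image_image]
  rfl

omit [NeZero M] in
/-- **The rate-decoupled carrier as a label-then-position double sum**: for `w = (y, ℓ)`,
`klWtPinnedSumAt … J j (m+1) T q w = ε^m Σ_{σ : σ q = ℓ} Σ_{x : x q = y} klScaleWt_j(pos x)·‖W^{F_J}_σ(T)(x)‖`. -/
theorem klWtPinnedSumAt_succ_eq_sum_sector (β μ : ℝ) (K : TrigPolyC4v) (J j m : ℕ) (T : HubbardGrassmann L M) (q : Fin (m + 1))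
    (y : SpaceTimeIdx L M) (ℓ : SectorLeg (sectorCount J)) :
    klWtPinnedSumAt L M β μ K J j (m + 1) T q (y, ℓ) = imagTimeWeight β M ^ m *
      ∑ σ ∈ univ.filter (fun σ : Fin (m + 1) → SectorLeg (sectorCount J) => σ q = ℓ),
        ∑ x ∈ univ.filter (fun x : Fin (m + 1) → SpaceTimeIdx L M => x q = y),
          klScaleWt L M β j ((univ.image x).image (fun x : SpaceTimeIdx L M => (((((2 * (x.1 : ℕ) : ℕ)) : ZMod (2 * (2 * M)))), x.2))) *
            ‖sectorisedKernel L M β (klAnisoFamily L M β μ K klE0 J) T (m + 1) σ x‖ := by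
  rw [klWtPinnedSumAt_succ]
  congr 1
  rw [← sum_pinned_prod_eq (fun x σ =>
    klScaleWt L M β j ((univ.image x).image (fun x : SpaceTimeIdx L M => (((((2 * (x.1 : ℕ) : ℕ)) : ZMod (2 * (2 * M)))), x.2))) *
      ‖sectorisedKernel L M β (klAnisoFamily L M β μ K klE0 J) T (m + 1) σ x‖) q y ℓ]
  refine sum_congr rfl fun Y _ => ?_
  rw [kernel_map_sectorAnalysis, image_latticeLegPos_eq_image_pos]

/-! ## §2 The weighted jump at abstract overlap / count constants -/

/-- **THE WEIGHTED JUMP at abstract constants** (BGM 2006 (2.82)–(2.84), (2.88)–(2.90); any rate `j`).  For `k + 1 ≤ J′`, a momentum-conserving `T`,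
PAIR-WEIGHTED per-pair column sums `≤ c₁` and row sums `≤ c₁r` of `‖E(klAnisoFamily J′)·S(F̃_k)‖` (weight `klScaleWt … j` on the two lattice positions, labels
matched — p3's shape), and the relative count with the prescribed legs fixed and one further leg determined (p4's shape, constant `D`): if every coarse pinned sum at
the same leg and rate is `≤ N`, then `klWtPinnedSumAt … J′ j (m+1) T q w ≤ c₁^m·c₁r·ε^{m+1}·(D·27^{m+1})·(2^{J′−k})^{m−1}·N`.
[cite: BenfattoGiulianiMastropietro2006, §2.8 (2.82)-(2.84), (2.88)-(2.90)] -/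
theorem klWtPinnedSumAt_jump_le_of_consts {β : ℝ} (hβ : 0 < β) (μ : ℝ) (K : TrigPolyC4v) {k J' : ℕ} (hJ : k + 1 ≤ J')
    (T : HubbardGrassmann L M)
    (hT : ∀ (m : ℕ) (X : Fin m → HubbardFieldIdx L M), ∑ i, signedMomentum L (X i).2 (X i).1.1.2 ≠ 0 → kernel ℂ T m X = 0)
    (j : ℕ) {c₁ c₁r D : ℝ} (hc₁0 : 0 ≤ c₁) (hc₁r0 : 0 ≤ c₁r) (hD : 0 ≤ D)
    (hcol₁ : ∀ (ω'' : Fin (sectorCount J')) (ω' : Fin (sectorCount k)) (σ c : Fin 2) (x' : SpaceTimeIdx L M),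
      ∑ x'' : SpaceTimeIdx L M, ‖(sectorAnalysisMatrix L M β (klAnisoFamily L M β μ K klE0 J') *
        sectorSubMatrix L M β (bgmFatMultiplier L M klE0 β (nambuXiCT L μ K) k)) (x'', ((ω'', σ), c)) (x', ((ω', σ), c))‖ *
          klScaleWt L M β j
            {latticeLegPos (2 * (2 * M)) ((x'', ((ω'', σ), c)) : SpaceTimeIdx L M × SectorLeg (sectorCount J')),
              latticeLegPos (2 * (2 * M)) ((x', ((ω', σ), c)) : SpaceTimeIdx L M × SectorLeg (sectorCount k))} ≤ c₁)
    (hrow₁ : ∀ (ω'' : Fin (sectorCount J')) (ω' : Fin (sectorCount k)) (σ c : Fin 2) (x'' : SpaceTimeIdx L M),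
      ∑ x' : SpaceTimeIdx L M, ‖(sectorAnalysisMatrix L M β (klAnisoFamily L M β μ K klE0 J') *
        sectorSubMatrix L M β (bgmFatMultiplier L M klE0 β (nambuXiCT L μ K) k)) (x'', ((ω'', σ), c)) (x', ((ω', σ), c))‖ *
          klScaleWt L M β j
            {latticeLegPos (2 * (2 * M)) ((x'', ((ω'', σ), c)) : SpaceTimeIdx L M × SectorLeg (sectorCount J')),
              latticeLegPos (2 * (2 * M)) ((x', ((ω', σ), c)) : SpaceTimeIdx L M × SectorLeg (sectorCount k))} ≤ c₁r)
    (m : ℕ)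
    (hcnt : ∀ (E : Finset (Fin (m + 1))) (τ'' : Fin (m + 1) → SectorLeg (sectorCount J'))
      (σ' : Fin (m + 1) → SectorLeg (sectorCount k)),
      ((((bgmSectorSet L M (klAnisoFamily L M β μ K klE0 J') (m + 1)).filter fun σ'' => (∀ e ∈ E, σ'' e = τ'' e) ∧ ∀ i,
        (∃ q : FreqMomentum L M, klAnisoFamily L M β μ K klE0 J' (σ'' i).1.1 q ≠ 0 ∧
          bgmFatMultiplier L M klE0 β (nambuXiCT L μ K) k (σ' i).1.1 q ≠ 0) ∧
        (σ' i).1.2 = (σ'' i).1.2 ∧ (σ' i).2 = (σ'' i).2).card : ℝ)) ≤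
        D * ((27 * 2 ^ (J' - k) : ℕ) : ℝ) ^ ((m + 1) - E.card - 1))
    (q : Fin (m + 1)) (w : SpaceTimeIdx L M × SectorLeg (sectorCount J')) {N : ℝ} (hN0 : 0 ≤ N)
    (hN : ∀ w' : SpaceTimeIdx L M × SectorLeg (sectorCount k), klWtPinnedSumAt L M β μ K k j (m + 1) T q w' ≤ N) :
    klWtPinnedSumAt L M β μ K J' j (m + 1) T q w ≤
      c₁ ^ m * c₁r * imagTimeWeight β M ^ (m + 1) * (D * 27 ^ (m + 1)) * ((2 : ℝ) ^ (J' - k)) ^ (m - 1) * N := by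
  have hε0 : 0 ≤ imagTimeWeight β M := imagTimeWeight_nonneg hβ.le M
  set ε := imagTimeWeight β M with hεdef
  set F' := klAnisoFamily L M β μ K klE0 J' with hF'
  set Fk := klAnisoFamily L M β μ K klE0 k with hFk
  set gpos : SpaceTimeIdx L M → ZMod (2 * (2 * M)) × TorusSite 2 L :=
    fun x => (((((2 * (x.1 : ℕ) : ℕ)) : ZMod (2 * (2 * M)))), x.2) with hgpos
  have hwt : IsTreeWeight (klScaleWt L M β j) := isTreeWeight_klScaleWt L M hβ.le j
  obtain ⟨y, ℓ⟩ := w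
  set E : Finset (Fin (m + 1)) := {q} with hE
  set τ'' : Fin (m + 1) → SectorLeg (sectorCount J') := fun _ => ℓ with hτ''
  have hqE : q ∈ E := by simp [hE]
  have hfilt : ∀ {Ns : ℕ} (ℓ₀ : SectorLeg Ns),
      (univ.filter fun σ : Fin (m + 1) → SectorLeg Ns => σ q = ℓ₀) = univ.filter fun σ => ∀ e ∈ E, σ e = (fun _ : Fin (m + 1) => ℓ₀) e := by
    intro Ns ℓ₀
    exact filter_congr fun σ _ => by simp [hE]
  -- (1) the carrier at `F_{J′}` as the `E`-prescribed fine sum over `bgmSectorSet`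
  have h1 : klWtPinnedSumAt L M β μ K J' j (m + 1) T q (y, ℓ) =
      ε ^ m * ∑ σ'' ∈ (bgmSectorSet L M F' (m + 1)).filter (fun σ'' => ∀ e ∈ E, σ'' e = τ'' e),
        ∑ x'' ∈ univ.filter (fun x'' : Fin (m + 1) → SpaceTimeIdx L M => x'' q = y),
          klScaleWt L M β j ((univ.image x'').image gpos) * ‖sectorisedKernel L M β F' T (m + 1) σ'' x''‖ := by
    rw [klWtPinnedSumAt_succ_eq_sum_sector, hfilt ℓ]
    congr 1
    have hsub : (bgmSectorSet L M F' (m + 1)).filter (fun σ'' => ∀ e ∈ E, σ'' e = τ'' e) ⊆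
        univ.filter (fun σ'' : Fin (m + 1) → SectorLeg (sectorCount J') => ∀ e ∈ E, σ'' e = τ'' e) :=
      filter_subset_filter _ (subset_univ _)
    refine (Finset.sum_subset hsub fun σ'' hσ''univ hσ''not => ?_).symm
    have hP := (mem_filter.1 hσ''univ).2
    have hnot : σ'' ∉ bgmSectorSet L M F' (m + 1) := fun h => hσ''not (mem_filter.2 ⟨h, hP⟩)
    exact sum_eq_zero fun x'' _ => by rw [sectorisedKernel_eq_zero_of_not_mem_bgmSectorSet β F' T hT hnot x'', norm_zero, mul_zero]
  -- (2) the coarse `E`-prescribed sums are the coarse carriers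
  have hN₁ : ∀ (τ' : Fin (m + 1) → SectorLeg (sectorCount k)) (y' : SpaceTimeIdx L M),
      ε ^ m * ∑ σ' ∈ univ.filter (fun σ' : Fin (m + 1) → SectorLeg (sectorCount k) => ∀ e ∈ E, σ' e = τ' e),
        ∑ x' ∈ univ.filter (fun x' : Fin (m + 1) → SpaceTimeIdx L M => x' q = y'),
          klScaleWt L M β j ((univ.image x').image gpos) * ‖sectorisedKernel L M β Fk T (m + 1) σ' x'‖ ≤ N := by
    intro τ' y'
    have hτ'E : (univ.filter fun σ' : Fin (m + 1) → SectorLeg (sectorCount k) => ∀ e ∈ E, σ' e = τ' e) =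
        univ.filter fun σ' => ∀ e ∈ E, σ' e = (fun _ : Fin (m + 1) => τ' q) e :=
      filter_congr fun σ _ => by simp [hE]
    rw [hτ'E, ← hfilt (τ' q), ← klWtPinnedSumAt_succ_eq_sum_sector]
    exact hN (y', τ' q)
  -- (3) the tree-weighted re-sectorisation lemma with the empty on-class set
  have hX0 : (0 : ℝ) ≤ D * ((27 * 2 ^ (J' - k) : ℕ) : ℝ) ^ ((m + 1) - E.card - 1) := by positivity
  have h2 := hubbardSectorPrescribedSumWt_klAniso_jump_le_split (L := L) (M := M) hwt gpos hβ μ K hJ T hc₁0 hc₁r0 hX0 le_rfl hN0 le_rfl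
    hcol₁ hrow₁ m (bgmSectorSet L M F' (m + 1)) ∅ E τ'' q hqE (fun σ' _ => hcnt E τ'' σ') (fun σ' h => absurd h (Finset.notMem_empty _)) hN₁
    (fun τ' y' => by simp) y
  -- (4) assemble
  rw [h1]
  refine h2.trans ?_
  rw [zero_mul, add_zero]
  have hcard : E.card = 1 := by simp [hE]
  have harith := legSet_count_arith hD (J' - k) m 1 E.card (by omega) (by omega)
  have hrest : 0 ≤ c₁ ^ m * c₁r * ε ^ (m + 1) * N := by positivity
  calc c₁ ^ m * c₁r * (27 : ℝ) ^ E.card * ε ^ m * (ε * (D * ((27 * 2 ^ (J' - k) : ℕ) : ℝ) ^ ((m + 1) - E.card - 1) * N))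
      = (c₁ ^ m * c₁r * ε ^ (m + 1) * N) * ((27 : ℝ) ^ E.card * (D * ((27 * 2 ^ (J' - k) : ℕ) : ℝ) ^ ((m + 1) - E.card - 1))) := by ring
    _ ≤ (c₁ ^ m * c₁r * ε ^ (m + 1) * N) * (D * 27 ^ (m + 1) * ((2 : ℝ) ^ (J' - k)) ^ (m - 1)) :=
        mul_le_mul_of_nonneg_left harith hrest
    _ = c₁ ^ m * c₁r * ε ^ (m + 1) * (D * 27 ^ (m + 1)) * ((2 : ℝ) ^ (J' - k)) ^ (m - 1) * N := by ring

/-! ## §3 The weighted jump at the flow frame on p3's deep window, constants discharged -/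

/-- **THE WEIGHTED JUMP IN THE KL REGIME AT THE FLOW FRAME, constants discharged on the deep window** — p3's binder list of
`overlapWt_jump_sums_klEng_flow_deep d` verbatim (`R.WF2`, `0 < cc ≤ klEngC₃6 P R`, `μ ∈ klWindowC`, `0 < U ≤ min (klEngU₀3 P R cc) (1/(Gfr₃+1))`,
`klBetaMin ≤ β ≤ e^{cc/U²}`, `klEngL₃`, `klEngM₃`, `1 ≤ n ≤ nScales β + 1`, `HistP klPredsV17F2 … 0 n`, `FrameOK R U (nScales β) μ K_n`, `k + 1 ≤ J′ ≤ n`,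
`4ⁿ·U ≤ 4^{2(k+1)+d}`) plus the count's thresholds `cc ≤ c₃′(R)`, `U ≤ U₀′(R)`: for every number of legs `m + 1` there is `C_m > 0` with, for every
momentum-conserving `T`, rate `j ≥ J′`, pinned leg `q`, pin `w` and bound `N` of the coarse carriers,
`klWtPinnedSumAt … J′ j (m+1) T q w ≤ C_m·(2^{J′−k})^{m−1}·N` at `K = K_n`. [cite: BenfattoGiulianiMastropietro2006, §2.8 (2.82)-(2.84), (2.88)-(2.90)] -/
theorem klWtPinnedSumAt_jump_le_klEng_flow_deep (dd m : ℕ) :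
    ∃ C : ℝ, 0 < C ∧ ∀ R : RenConsts, R.WF2 → ∃ c₃' : ℝ, 0 < c₃' ∧ ∃ U₀' : ℝ, 0 < U₀' ∧
      ∀ (G : GeoConsts) (P : SplitConsts) (Q : EngConsts) (cc : ℝ), 0 < cc → cc ≤ klEngC₃6 P R → cc ≤ c₃' →
      ∀ μ ∈ klWindowC, ∀ U : ℝ, 0 < U → U ≤ min (klEngU₀3 P R cc) (1 / (R.Gfr 3 + 1)) → U ≤ U₀' →
      ∀ β : ℝ, klBetaMin ≤ β → β ≤ Real.exp (cc / U ^ 2) →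
      ∀ (L M : ℕ) [NeZero L] [NeZero M], klEngL₃ β U ≤ L → klEngM₃ β U L ≤ M →
      ∀ n : ℕ, 1 ≤ n → n ≤ nScales β + 1 →
        HistP klPredsV17F2 L M G P Q R β U μ 0 n → FrameOK R U (nScales β) μ (klFlowFrameU L M β U μ n) →
        ∀ k J' : ℕ, k + 1 ≤ J' → J' ≤ n → (4 : ℝ) ^ n * U ≤ (4 : ℝ) ^ (2 * (k + 1) + dd) →
        ∀ T : HubbardGrassmann L M,
          (∀ (m' : ℕ) (X : Fin m' → HubbardFieldIdx L M), ∑ i, signedMomentum L (X i).2 (X i).1.1.2 ≠ 0 → kernel ℂ T m' X = 0) →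
        ∀ j : ℕ, J' ≤ j → ∀ (q : Fin (m + 1)) (w : SpaceTimeIdx L M × SectorLeg (sectorCount J')) (N : ℝ), 0 ≤ N →
          (∀ w' : SpaceTimeIdx L M × SectorLeg (sectorCount k),
            klWtPinnedSumAt L M β μ (klFlowFrameU L M β U μ n) k j (m + 1) T q w' ≤ N) →
          klWtPinnedSumAt L M β μ (klFlowFrameU L M β U μ n) J' j (m + 1) T q w ≤ C * ((2 : ℝ) ^ (J' - k)) ^ (m - 1) * N := by
  obtain ⟨CJ, hCJ, hov⟩ := overlapWt_jump_sums_klEng_flow_deep dd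
  obtain ⟨D, hD, hreg⟩ := card_relCount_prescribed_lastLeg_klAniso_le_window m
  refine ⟨(3 * CJ / 2) ^ (m + 1) * (D * 27 ^ (m + 1)), by positivity, fun R hR2 => ?_⟩
  have hRj : ∀ j, 0 ≤ R.Gfr j := gfr_nonneg_of_wf2 hR2
  obtain ⟨c₃, hc₃, U₀, hU₀, hcnt⟩ := hreg R hRj
  refine ⟨c₃, hc₃, U₀, hU₀, ?_⟩
  intro G P Q cc hcc hcc6 hcc₃' μ hμ U hU hUle hU₀' β hβmin hβc L M _ _ hL3 hM3 n hn1 hnN hhist hfr k J' hJ hJn hwin T hT j hjJ q w N hN0 hN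
  have hβ : 0 < β := KLRegimeSplit.pos_of_klBetaMin_le hβmin
  set K : TrigPolyC4v := klFlowFrameU L M β U μ n with hK
  obtain ⟨_, hcolJ, hrowJ⟩ := hov G P R Q cc hR2 hcc hcc6 μ hμ U hU hUle β hβmin hβc L M hL3 hM3 n hn1 hnN hhist hfr k J' hJ hJn hwin
  have hc₁0 : (0 : ℝ) ≤ 3 * CJ * M / β := by positivity
  -- rate `j ≥ J′`: the weight only decreases
  have hcol₁ : ∀ (ω'' : Fin (sectorCount J')) (ω' : Fin (sectorCount k)) (σ c : Fin 2) (x' : SpaceTimeIdx L M),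
      ∑ x'' : SpaceTimeIdx L M, ‖(sectorAnalysisMatrix L M β (klAnisoFamily L M β μ K klE0 J') *
        sectorSubMatrix L M β (bgmFatMultiplier L M klE0 β (nambuXiCT L μ K) k)) (x'', ((ω'', σ), c)) (x', ((ω', σ), c))‖ *
          klScaleWt L M β j
            {latticeLegPos (2 * (2 * M)) ((x'', ((ω'', σ), c)) : SpaceTimeIdx L M × SectorLeg (sectorCount J')),
              latticeLegPos (2 * (2 * M)) ((x', ((ω', σ), c)) : SpaceTimeIdx L M × SectorLeg (sectorCount k))} ≤ 3 * CJ * M / β := by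
    intro ω'' ω' σ c x'
    refine le_trans (sum_le_sum fun x'' _ => mul_le_mul_of_nonneg_left (klScaleWt_le_of_le β hjJ _) (norm_nonneg _)) ?_
    exact hcolJ ω'' ω' σ c x'
  have hrow₁ : ∀ (ω'' : Fin (sectorCount J')) (ω' : Fin (sectorCount k)) (σ c : Fin 2) (x'' : SpaceTimeIdx L M),
      ∑ x' : SpaceTimeIdx L M, ‖(sectorAnalysisMatrix L M β (klAnisoFamily L M β μ K klE0 J') *
        sectorSubMatrix L M β (bgmFatMultiplier L M klE0 β (nambuXiCT L μ K) k)) (x'', ((ω'', σ), c)) (x', ((ω', σ), c))‖ *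
          klScaleWt L M β j
            {latticeLegPos (2 * (2 * M)) ((x'', ((ω'', σ), c)) : SpaceTimeIdx L M × SectorLeg (sectorCount J')),
              latticeLegPos (2 * (2 * M)) ((x', ((ω', σ), c)) : SpaceTimeIdx L M × SectorLeg (sectorCount k))} ≤ 3 * CJ * M / β := by
    intro ω'' ω' σ c x''
    refine le_trans (sum_le_sum fun x' _ => mul_le_mul_of_nonneg_left (klScaleWt_le_of_le β hjJ _) (norm_nonneg _)) ?_
    exact hrowJ ω'' ω' σ c x''
  have hJN : J' ≤ nScales β + 1 := hJn.trans hnN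
  have h := klWtPinnedSumAt_jump_le_of_consts hβ μ K hJ T hT j hc₁0 hc₁0 hD.le hcol₁ hrow₁ m
    (fun E τ'' σ' => hcnt cc hcc hcc₃' U hU hU₀' β hβmin hβc μ hμ μ K hfr L M k J' (by omega) _ subset_rfl E τ'' σ') q w hN0 hN
  have hMne : (M : ℝ) ≠ 0 := by exact_mod_cast NeZero.ne M
  have hεc : imagTimeWeight β M * (3 * CJ * M / β) = 3 * CJ / 2 := by
    unfold imagTimeWeight; field_simp
  have hconst : (3 * CJ * M / β) ^ m * (3 * CJ * M / β) * imagTimeWeight β M ^ (m + 1) = (3 * CJ / 2) ^ (m + 1) := by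
    rw [← pow_succ, ← mul_pow, mul_comm (3 * CJ * M / β), hεc]
  calc klWtPinnedSumAt L M β μ K J' j (m + 1) T q w
      ≤ (3 * CJ * M / β) ^ m * (3 * CJ * M / β) * imagTimeWeight β M ^ (m + 1) * (D * 27 ^ (m + 1)) *
          ((2 : ℝ) ^ (J' - k)) ^ (m - 1) * N := h
    _ = (3 * CJ / 2) ^ (m + 1) * (D * 27 ^ (m + 1)) * ((2 : ℝ) ^ (J' - k)) ^ (m - 1) * N := by rw [hconst]

/-! ## §4 (appended) The tower row: an increment born at `F_{dk′}` re-measured at `F_{dk−1}`, weighted track, flow frame, deep window -/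

/-- **THE INCREMENT `Δ_{k′}` RE-MEASURED AT `F_{dk−1}`, weighted track** (`k′ < k`, `2 ≤ d`, `dk − 1 ≤ n`; flow frame `K_n`, p3's deep window at the COARSE family
`4ⁿ·U ≤ 4^{2(dk′+1)+dd}`; every rate `j ≥ dk − 1`, every pinned leg / pin): the summand `k′` of E1's `klTowerMeasWt[At]_le_remeasured_sum` against the BORN size,
`klWtPinnedSumAt … (dk−1) j (m+1) Δ_{k′} q w ≤ C_m·(2^{(dk−1)−dk′})^{m−1}·klTowerBornWtAt … d k′ j (m+1)`.
[cite: BenfattoGiulianiMastropietro2006, §2.8 (2.82)-(2.84), (2.88)-(2.90)] -/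
theorem klWtPinnedSumAt_klTowerIncr_remeasure_le_klEng_flow_deep (dd m : ℕ) :
    ∃ C : ℝ, 0 < C ∧ ∀ R : RenConsts, R.WF2 → ∃ c₃' : ℝ, 0 < c₃' ∧ ∃ U₀' : ℝ, 0 < U₀' ∧
      ∀ (G : GeoConsts) (P : SplitConsts) (Q : EngConsts) (cc : ℝ), 0 < cc → cc ≤ klEngC₃6 P R → cc ≤ c₃' →
      ∀ μ ∈ klWindowC, ∀ U : ℝ, 0 < U → U ≤ min (klEngU₀3 P R cc) (1 / (R.Gfr 3 + 1)) → U ≤ U₀' →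
      ∀ β : ℝ, klBetaMin ≤ β → β ≤ Real.exp (cc / U ^ 2) →
      ∀ (L M : ℕ) [NeZero L] [NeZero M], klEngL₃ β U ≤ L → klEngM₃ β U L ≤ M →
      ∀ n : ℕ, 1 ≤ n → n ≤ nScales β + 1 →
        HistP klPredsV17F2 L M G P Q R β U μ 0 n → FrameOK R U (nScales β) μ (klFlowFrameU L M β U μ n) →
        ∀ d k k' : ℕ, 2 ≤ d → k' < k → d * k - 1 ≤ n → (4 : ℝ) ^ n * U ≤ (4 : ℝ) ^ (2 * (d * k' + 1) + dd) →
        ∀ j : ℕ, d * k - 1 ≤ j → ∀ (q : Fin (m + 1)) (w : SpaceTimeIdx L M × SectorLeg (sectorCount (d * k - 1))),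
          klWtPinnedSumAt L M β μ (klFlowFrameU L M β U μ n) (d * k - 1) j (m + 1)
              (klTowerIncr L M β U μ (klFlowFrameU L M β U μ n) d k') q w ≤
            C * ((2 : ℝ) ^ (d * k - 1 - d * k')) ^ (m - 1) *
              klTowerBornWtAt L M β U μ (klFlowFrameU L M β U μ n) d k' j (m + 1) := by
  obtain ⟨C, hC, h⟩ := klWtPinnedSumAt_jump_le_klEng_flow_deep dd m
  refine ⟨C, hC, fun R hR2 => ?_⟩
  obtain ⟨c₃, hc₃, U₀, hU₀, h'⟩ := h R hR2
  refine ⟨c₃, hc₃, U₀, hU₀, ?_⟩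
  intro G P Q cc hcc hcc6 hcc₃' μ hμ U hU hUle hU₀' β hβmin hβc L M _ _ hL3 hM3 n hn1 hnN hhist hfr d k k' hd hk hkn hwin j hj q w
  have hβ : 0 < β := KLRegimeSplit.pos_of_klBetaMin_le hβmin
  exact h' G P Q cc hcc hcc6 hcc₃' μ hμ U hU hUle hU₀' β hβmin hβc L M hL3 hM3 n hn1 hnN hhist hfr (d * k') (d * k - 1) (block_jump_le hd hk) hkn
    hwin (klTowerIncr L M β U μ _ d k') (fun m' X hX => klTowerIncr_momentumConserving β U μ _ d k' m' X hX) j hj q w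
    (klTowerBornWtAt L M β U μ _ d k' j (m + 1)) (klTowerBornWtAt_nonneg hβ.le U μ _ d k' j (m + 1))
    (fun w' => klWtPinnedSumAt_le_klTowerBornWtAt β U μ _ d k' j (m + 1) q w')

end Summit.HubbardSuperconductivity.HubbardSuperconductivity.Theorems.EngineV8

end
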